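import Summits.CriticalPhenomena.SAWScalingLimit.Theses.SAWTwistedSelfEnergy
import Literature.Probability.RandomPlanarGeometry.TwistedLaceExpansionIdentity

/-!
# Sketch — first lemmas of the crux-ideate cards for `DomainTransfer` (stmt-CriticalPhenomena-17875)

Ideator `planner-cruxidea-stmt-CriticalPhenomena-17875-2-0`, round 1.  Nothing here is a line or a
stub: these are the FIRST CHECKABLE STATEMENTS of the two idea cards, typed over the repaired
(first-step) twisted lace vocabulary of `TwistedLaceCoefficient.lean` (`Π^σ_n = twistedLaceCoefficient σ n`,
`T_σ = twistedStepMatrix σ`, `e_b = stepDir b`), so that they survive the pending restate R1 of the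
kernel items (Disproof.lean of this crux: the crux is vacuous as typed; after R1 + first-step free term
the kernel is `Π^{5/8}` uniquely, `Cruxes/TwistedKernelSummable/Disproof.lean` §3).

Sectors: `ℤ₄` acts on direction labels; sector `j` pairs the last-step label `b` with `i^{jb}` and the
root label `a` with `i^{-ja}`.  Sector 0 is the Duminil-Copin–Smirnov spin-5/8 observable; sector 1 is
the spin-(−3/8) parafermion (the route's `TwistedGapEquation` is stated in sector 1).
-/

noncomputable section

open Filter Topology
open scoped BigOperators Topology Classical Matrix
open Literature.Probability.RandomPlanarGeometry Literature.Probability.LatticeModels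
open Literature.Probability.RandomPlanarGeometry.LaceExpansion

namespace Summit.CriticalPhenomena.SAWScalingLimit.Cruxes.DomainTransfer.Ideas

/-- `x_c = 1/μ(ℤ²)` as a complex number. -/
def xc : ℂ := (SAW.criticalFugacity : ℂ)

/-- The plane wave `e^{i k·z}` on `ℤ²`. -/
def wave (k : ℝ × ℝ) (z : Site 2) : ℂ :=
  Complex.exp (Complex.I * ((k.1 * (z 0 : ℝ) + k.2 * (z 1 : ℝ) : ℝ) : ℂ))

/-- `|k|`. -/
def knorm (k : ℝ × ℝ) : ℝ := Real.sqrt (k.1 ^ 2 + k.2 ^ 2)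

/-- Free symbol `T̂(k)(a,b) = T_{5/8}(a,b) e^{i k·e_b}` (first-step convention: the step `b` displaces by `e_b`). -/
def symbolT (k : ℝ × ℝ) : Matrix (Fin 4) (Fin 4) ℂ :=
  fun a b => twistedStepMatrix (5 / 8) a b * wave k (stepDir b)

/-- Kernel symbol `K̂(k) = Σ_{n,z} x_c^n Π^{5/8}_n(z) e^{i k·z}` (a `tsum`; junk `0` if not summable —
its absolute summability at every `k` is exactly `TwistedKernelSummable` after repair). -/
def symbolK (k : ℝ × ℝ) : Matrix (Fin 4) (Fin 4) ℂ :=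
  fun a b => ∑' p : ℕ × Site 2, xc ^ p.1 * wave k p.2 * twistedLaceCoefficient (5 / 8) p.1 p.2 a b

/-- The twisted resolvent symbol `M̂(k) = I − x_c T̂(k) − K̂(k)`. -/
def symbolM (k : ℝ × ℝ) : Matrix (Fin 4) (Fin 4) ℂ :=
  1 - xc • symbolT k - symbolK k

/-- Sector bracket `⟨j| M̂(k) |j'⟩ = Σ_{a,b} i^{-ja} M̂(k)(a,b) i^{j'b}`. -/
def sectorSymbol (j j' : ℤ) (k : ℝ × ℝ) : ℂ :=
  ∑ a : Fin 4, ∑ b : Fin 4, Complex.I ^ (-(j * (a : ℕ) : ℤ)) * symbolM k a b * Complex.I ^ (j' * (b : ℕ) : ℤ)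

/-- **SectorZeroGapEquation** — the gap equation in the DCS sector (spin 5/8), which `DomainTransfer`
needs and which is NOT the route's `TwistedGapEquation` (that one is sector 1, spin −3/8):
`x_c(1 + 2cos(5π/16)) + Σ_{n,z} x_c^n Σ_{a,b} Π_n(z)(a,b) /4 ... = 1`, stated as `⟨0|M̂(0)|0⟩ = 0`.
Numerically corroborated (Cruxes/TwistedGapEquation/NUMERICS.md, sector 0: `1 − S⁰_N = 0.052` at N = 24,
approach exponent 0.53–0.55 vs CFT `γ₀ = 9/16`). -/
def SectorZeroGapEquation : Prop :=
  sectorSymbol 0 0 (0, 0) = 0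

/-- **InterSectorWard** — the first-moment sum rule that decouples the DCS sector from the slower
sector 1 at small momentum: the LINEAR term of `⟨0|M̂(k)|1⟩` vanishes.  The free part contributes
`2i x_c λ₀ (k₁ + i k₂)` (`λ₀ = 1 + 2cos(5π/16)` = column sums of `T_{5/8}`), so the kernel's first moment
in the (0,1) channel must equal `−2 x_c λ₀`: `Σ_{n,z} x_c^n z₁ Σ_{a,b} Π_n(z)(a,b) i^b = −2 x_c λ₀ ≈ −1.600`.
Forced by scale covariance with the sector exponents (3/4, 17/12) and any mixed exponent > 1; exact,
enumerable (position-resolved `Π_n`, n ≤ 24, one kit job). -/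
def InterSectorWard : Prop :=
  (∑' p : ℕ × Site 2, xc ^ p.1 * ((p.2 0 : ℝ) : ℂ) *
      ∑ a : Fin 4, ∑ b : Fin 4, twistedLaceCoefficient (5 / 8) p.1 p.2 a b * Complex.I ^ (b : ℕ)) =
    -2 * xc * ((1 + 2 * Real.cos (5 * Real.pi / 16) : ℝ) : ℂ)

/-- **SectorZeroChiralGerm** (card `riesz-screening`, first lemma): in the DCS sector the critical
twisted resolvent is, at small momentum, the Riesz potential of order −1/4 composed with `∂̄`:
`⟨0|M̂(k)|0⟩ = c |k|^{-1/4} (k₁ + i k₂) + o(|k|^{3/4})` with `c ≠ 0` — operator form of (tail abscissa 3/4)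
∧ (sector-0 gap equation) ∧ (chiral purity).  (The conjugate orientation `k₁ − i k₂` is the other
admissible reading; the card fixes it by the sign of the spin.) -/
def SectorZeroChiralGerm : Prop :=
  ∃ c : ℂ, c ≠ 0 ∧
    Tendsto (fun k : ℝ × ℝ =>
        (sectorSymbol 0 0 k - c * ((knorm k ^ (-(1 / 4 : ℝ)) : ℝ) : ℂ) * ((k.1 : ℂ) + Complex.I * k.2)) /
          ((knorm k ^ (3 / 4 : ℝ) : ℝ) : ℂ))
      (𝓝[≠] (0, 0)) (𝓝 0)

/-- **TwistedSymbolElliptic** (card `tip-dressing-parametrix`, whole-plane input of the parametrix):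
away from `k = 0` the 4×4 symbol is invertible on the torus, and at `k = 0` exactly the two parafermion
sectors 0 and 1 are critical (sectors 2, 3 gapped: `χ₂ = 0.967`, `χ₃ = 0.805` finite,
Cruxes/TwistedGapEquation/NUMERICS.md).  Stated as: `det M̂(k) ≠ 0` for `k ∈ [-π,π]² ∖ {0}`. -/
def TwistedSymbolElliptic : Prop :=
  ∀ k : ℝ × ℝ, k ≠ (0, 0) → |k.1| ≤ Real.pi → |k.2| ≤ Real.pi → (symbolM k).det ≠ 0

/-- **TipDressingTail** (card `tip-dressing-parametrix`, first lemma, whole-plane shadow of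
ε-decoupling): the sector-0 zero mode of the kernel restricted to lengths `> N` is `O(N^{-1/2-δ})` for
some `δ > 0` — although the one-loop (rooted polygon) part alone is `≍ N^{-1/2}` with a non-zero
coefficient `−√2 λ₀ R₀` (left–right symmetry of the closing turn of large polygons), i.e. the higher
lace orders cancel the energy-operator channel at the root.  (`δ = 1/16` is the CFT value `γ₀ = 9/16`.) -/
def TipDressingTail : Prop :=
  ∃ δ > (0 : ℝ), ∃ C : ℝ, ∀ N : ℕ, 1 ≤ N →
    ‖∑' p : ℕ × Site 2, (if N < p.1 then xc ^ p.1 *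
        ∑ a : Fin 4, ∑ b : Fin 4, twistedLaceCoefficient (5 / 8) p.1 p.2 a b else 0)‖ ≤
      C * (N : ℝ) ^ (-(1 / 2 : ℝ) - δ)

/-- **InterSectorDecay** (whole-plane two-point input shared by both cards): the mixed (0,1) two-point
bracket decays one power faster than scale covariance alone allows —
`|Σ_{a,b} G(z)(a,b) i^b| ≤ C |z|^{-(5/8 + 7/24) - 1 + ε}` — the lattice shadow of Möbius covariance
(distinct primaries ψ_{5/8}, ψ_{-3/8} have no common leading scaling operator); NOT derivable from scale
covariance (barrier `TwoPointLawNotMoebius`), hence an explicit hypothesis.  `G = Σ_n x_c^n G_n`. -/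
def InterSectorDecay : Prop :=
  ∀ ε > (0 : ℝ), ∃ C : ℝ, ∀ z : Site 2, z ≠ 0 →
    ‖∑' n : ℕ, xc ^ n * ∑ a : Fin 4, ∑ b : Fin 4, twistedTwoPoint (5 / 8) n z a b * Complex.I ^ (b : ℕ)‖ ≤
      C * ‖Site.toComplex z‖ ^ (-(5 / 8 + 7 / 24 + 1 : ℝ) + ε)

end Summit.CriticalPhenomena.SAWScalingLimit.Cruxes.DomainTransfer.Ideas

end
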